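import Mathlib
import Literature.Analysis.Calculus.RadialHardyTwoEdge
import Summits.FinalStateConjecture.FinalStateConjecture.Theorems.PhotonSphereChannelsUniformPhotonSphereChannelsRPeelHardy

/-!
# Peeling, file 13: the one-mode deficit is minimised at the edge-matching constant

Support file for `stub_peel` of the line `crum-peeling-recessive-tower` (crux
`UniformPhotonSphereChannelsR`, stmt-FinalStateConjecture-14074).  Let `u > 0` be the convex,
non-increasing, finite-energy static mode of `u'' = Q u` (`Q ≥ 0`) on `(a, ∞)` and let `f` be a
`C¹` function on `(a, ∞)` with `f(xf) = 0`, `f' ∈ L²(xf, ∞)`, `Q f² ∈ L¹(xf, ∞)`.  Then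

* `static_orthogonal` : `∫_{(xf,∞)} (f' u' + Q f u) = 0` (it is `[f u']_{xf}^∞`, and
  `f(Y) u'(Y) → 0` because `f(Y)² = o(Y)` while `|u'(Y)| ≤ u(xf)/(Y − xf)`);
* `deficit_le_of_shift` : consequently `∫ (A² + f'² + Q f²) ≤ ∫ (A² + (f' − d u')² + Q (f − d u)²)`
  for every `d` and every square-integrable `A` — the `Q`-energy distance from `φ(0,·)` to the
  line `ℝ u` is attained at the constant `c₀` with `(φ(0,·) − c₀ u)(xf) = 0`;
* `sq_div_integrableOn_of_deriv` : the classical Hardy inequality at infinity in qualitative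
  form, `h' ∈ L²(X, ∞) ⇒ h/x ∈ L²(X, ∞)` (`X > 0`).
-/

noncomputable section

-- the doubled `FinalStateConjecture` component is the tree's fixed summit/problem path
set_option linter.dupNamespace false

namespace Summit.FinalStateConjecture.FinalStateConjecture.Theorems.CrumPeelingRecessiveTower

open MeasureTheory Set Filter Topology intervalIntegral

/-- **Hardy at infinity, qualitative**: if `h` has a continuous derivative `h'` on `[X, ∞)`
(`X > 0`) with `h' ∈ L²(X, ∞)`, then `h/x ∈ L²(X, ∞)`. -/
theorem sq_div_integrableOn_of_deriv {h h' : ℝ → ℝ} {X : ℝ} (hX : 0 < X)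
    (hh : ∀ x, X ≤ x → HasDerivAt h (h' x) x) (hh'c : ContinuousOn h' (Ici X))
    (hh'2 : IntegrableOn (fun x => h' x ^ 2) (Ioi X)) :
    IntegrableOn (fun x => (h x / x) ^ 2) (Ioi X) := by
  have hhc : ContinuousOn h (Ici X) := fun x hx => (hh x hx).continuousAt.continuousWithinAt
  have hbound : ∀ Y, X ≤ Y → ∫ x in X..Y, (h x / x) ^ 2 ≤ 2 * (h X ^ 2 / X) + 4 * ∫ x in Ioi X, h' x ^ 2 := by
    intro Y hY
    have hH := Literature.Analysis.Calculus.hardy_sq_interval_le hX hY (fun r hr => hh r hr.1)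
      (hh'c.mono Icc_subset_Ici_self)
    have hpos : 0 ≤ h Y ^ 2 / Y := div_nonneg (sq_nonneg _) (hX.le.trans hY)
    have hle : ∫ x in X..Y, h' x ^ 2 ≤ ∫ x in Ioi X, h' x ^ 2 := by
      rw [intervalIntegral.integral_of_le hY]
      exact setIntegral_mono_set hh'2 (ae_of_all _ fun x => sq_nonneg _) (ae_of_all _ Ioc_subset_Ioi_self)
    have e : ∫ x in X..Y, (h x / x) ^ 2 = ∫ x in X..Y, h x ^ 2 / x ^ 2 :=
      intervalIntegral.integral_congr fun x _ => by rw [div_pow]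
    rw [e]
    linarith
  have hcont : ContinuousOn (fun x => (h x / x) ^ 2) (Ici X) :=
    (hhc.div continuousOn_id fun x hx => (hX.trans_le hx).ne').pow 2
  refine integrableOn_Ioi_of_intervalIntegral_norm_bounded (2 * (h X ^ 2 / X) + 4 * ∫ x in Ioi X, h' x ^ 2)
    X (l := atTop) (b := id) (fun Y => ?_) tendsto_id ?_
  · exact ((hcont.mono Icc_subset_Ici_self).integrableOn_compact isCompact_Icc).mono_set Ioc_subset_Icc_self
  · filter_upwards [Filter.eventually_ge_atTop X] with Y hY
    have : ∫ x in X..id Y, ‖(h x / x) ^ 2‖ = ∫ x in X..Y, (h x / x) ^ 2 :=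
      intervalIntegral.integral_congr fun x _ => by rw [Real.norm_eq_abs, abs_of_nonneg (sq_nonneg _)]
    rw [this]
    exact hbound Y hY

/-- **Orthogonality of the edge-matched remainder to the static mode**: see the module
docstring. -/
theorem static_orthogonal {a xf : ℝ} {Q u f df : ℝ → ℝ} (haxf : a < xf)
    (hQc : ContinuousOn Q (Ioi a)) (hQ0 : ∀ x, a < x → 0 ≤ Q x)
    (hu : ∀ x, a < x → HasDerivAt u (deriv u x) x)
    (hdu : ∀ x, a < x → HasDerivAt (deriv u) (Q x * u x) x) (hupos : ∀ x, a < x → 0 < u x)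
    (hdule : ∀ x, xf < x → |deriv u x| ≤ u xf / (x - xf))
    (huI1 : IntegrableOn (fun x => deriv u x ^ 2) (Ioi xf))
    (huI2 : IntegrableOn (fun x => Q x * u x ^ 2) (Ioi xf))
    (hf : ∀ x, a < x → HasDerivAt f (df x) x) (hdfc : ContinuousOn df (Ioi a)) (hf0 : f xf = 0)
    (hfI1 : IntegrableOn (fun x => df x ^ 2) (Ioi xf))
    (hfI2 : IntegrableOn (fun x => Q x * f x ^ 2) (Ioi xf)) :
    IntegrableOn (fun x => df x * deriv u x + Q x * f x * u x) (Ioi xf) ∧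
      ∫ x in Ioi xf, (df x * deriv u x + Q x * f x * u x) = 0 := by
  have huc : ContinuousOn u (Ioi a) := fun x hx => (hu x hx).continuousAt.continuousWithinAt
  have hduc : ContinuousOn (deriv u) (Ioi a) := fun x hx => (hdu x hx).continuousAt.continuousWithinAt
  have hfc : ContinuousOn f (Ioi a) := fun x hx => (hf x hx).continuousAt.continuousWithinAt
  have hsub : Ioi xf ⊆ Ioi a := Ioi_subset_Ioi haxf.le
  -- integrability of the pairing density
  have hI1 : IntegrableOn (fun x => df x * deriv u x) (Ioi xf) :=
    integrableOn_mul_of_sq ((hdfc.mono hsub).aestronglyMeasurable measurableSet_Ioi)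
      ((hduc.mono hsub).aestronglyMeasurable measurableSet_Ioi) hfI1 huI1
  have hI2 : IntegrableOn (fun x => Q x * f x * u x) (Ioi xf) := by
    refine ((hfI2.add huI2).div_const 2).mono'
      (((hQc.mul hfc).mul huc).mono hsub |>.aestronglyMeasurable measurableSet_Ioi) ?_
    filter_upwards [ae_restrict_mem measurableSet_Ioi] with x hx
    have hQ := hQ0 x (haxf.trans hx)
    rw [Real.norm_eq_abs, show Q x * f x * u x = Q x * (f x * u x) by ring, abs_mul, abs_of_nonneg hQ]
    simp only [Pi.add_apply]
    have : |f x * u x| ≤ (f x ^ 2 + u x ^ 2) / 2 := by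
      rw [abs_le]; constructor <;> nlinarith [sq_nonneg (f x + u x), sq_nonneg (f x - u x)]
    calc Q x * |f x * u x| ≤ Q x * ((f x ^ 2 + u x ^ 2) / 2) := mul_le_mul_of_nonneg_left this hQ
      _ = (Q x * f x ^ 2 + Q x * u x ^ 2) / 2 := by ring
  have hI : IntegrableOn (fun x => df x * deriv u x + Q x * f x * u x) (Ioi xf) := hI1.add hI2
  refine ⟨hI, ?_⟩
  -- `(f u')' = f' u' + Q f u` and the integral on `[xf, Y]`
  have hpd : ∀ x, a < x → HasDerivAt (fun y => f y * deriv u y) (df x * deriv u x + f x * (Q x * u x)) x :=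
    fun x hx => (hf x hx).mul (hdu x hx)
  have hint : ∀ Y, xf ≤ Y → ∫ x in xf..Y, (df x * deriv u x + Q x * f x * u x) = f Y * deriv u Y := by
    intro Y hY
    have hsub' : ∀ x ∈ uIcc xf Y, a < x := fun x hx => by
      rw [uIcc_of_le hY] at hx; exact haxf.trans_le hx.1
    have hci : IntervalIntegrable (fun x => df x * deriv u x + f x * (Q x * u x)) volume xf Y :=
      (((hdfc.mul hduc).add (hfc.mul (hQc.mul huc))).mono fun x hx =>
        hsub' x (by rw [uIcc_of_le hY]; exact hx)).intervalIntegrable_of_Icc hY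
    have h := integral_eq_sub_of_hasDerivAt (fun x hx => hpd x (hsub' x hx)) hci
    rw [hf0, zero_mul, sub_zero] at h
    rw [← h]
    exact intervalIntegral.integral_congr fun x _ => by ring
  -- the edge term `f(Y) u'(Y) → 0`
  have hedge : Tendsto (fun Y => f Y * deriv u Y) atTop (𝓝 0) := by
    have hsq : Tendsto (fun Y => f Y ^ 2 / Y) atTop (𝓝 0) :=
      tendsto_sq_div_self (fun y hy => hf y (haxf.trans_le hy)) (hdfc.mono fun y hy => haxf.trans_le hy)
        hfI1
    have hsq2 : Tendsto (fun Y => (4 * u xf ^ 2) * (f Y ^ 2 / Y)) atTop (𝓝 0) := by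
      simpa using hsq.const_mul (4 * u xf ^ 2)
    have hsq3 : Tendsto (fun Y => (f Y * deriv u Y) ^ 2) atTop (𝓝 0) := by
      refine squeeze_zero' (Filter.Eventually.of_forall fun Y => sq_nonneg _) ?_ hsq2
      filter_upwards [Filter.eventually_ge_atTop (max (max (2 * xf) (xf + 1)) 1)] with Y hY
      have hY1 : 1 ≤ Y := le_trans (le_max_right _ _) hY
      have hYf : xf < Y := by
        have : xf + 1 ≤ Y := le_trans (le_max_right _ _) (le_trans (le_max_left _ _) hY); linarith
      have hY2 : Y / 2 ≤ Y - xf := by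
        have : 2 * xf ≤ Y := le_trans (le_max_left _ _) (le_trans (le_max_left _ _) hY); linarith
      have hY0 : 0 < Y := by linarith
      have hd := hdule Y hYf
      have hu0 : 0 < u xf := hupos xf haxf
      have hd2 : |deriv u Y| ≤ 2 * u xf / Y := by
        refine hd.trans ?_
        rw [div_le_div_iff₀ (by linarith) hY0]
        nlinarith
      have h1 : (f Y * deriv u Y) ^ 2 = f Y ^ 2 * |deriv u Y| ^ 2 := by rw [mul_pow, sq_abs]
      rw [h1]
      have h2 : |deriv u Y| ^ 2 ≤ (2 * u xf / Y) ^ 2 := pow_le_pow_left₀ (abs_nonneg _) hd2 2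
      calc f Y ^ 2 * |deriv u Y| ^ 2 ≤ f Y ^ 2 * (2 * u xf / Y) ^ 2 :=
            mul_le_mul_of_nonneg_left h2 (sq_nonneg _)
        _ = (4 * u xf ^ 2) * (f Y ^ 2 / Y) * (1 / Y) := by field_simp; ring
        _ ≤ (4 * u xf ^ 2) * (f Y ^ 2 / Y) * 1 := by
            refine mul_le_mul_of_nonneg_left ?_ (by positivity)
            rw [div_le_one hY0]; exact hY1
        _ = (4 * u xf ^ 2) * (f Y ^ 2 / Y) := mul_one _
    have h := hsq3.sqrt
    rw [Real.sqrt_zero] at h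
    have h' : Tendsto (fun Y => |f Y * deriv u Y|) atTop (𝓝 0) := by
      refine h.congr fun Y => ?_
      exact Real.sqrt_sq_eq_abs _
    exact (tendsto_zero_iff_abs_tendsto_zero _).2 h'
  have hlim := intervalIntegral_tendsto_integral_Ioi xf hI tendsto_id
  refine tendsto_nhds_unique hlim (hedge.congr' ?_)
  filter_upwards [Filter.eventually_ge_atTop xf] with Y hY
  exact (hint Y hY).symm

/-- **The one-mode deficit is minimal at the edge-matched constant.**  With `u, f` as in
`static_orthogonal` and any square-integrable `A` on `(xf, ∞)`, for every real `d`: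
`∫ (A² + f'² + Q f²) ≤ ∫ (A² + (f' − d u')² + Q (f − d u)²)` (both integrable). -/
theorem deficit_le_of_shift {a xf : ℝ} {Q u f df A : ℝ → ℝ} (haxf : a < xf)
    (hQc : ContinuousOn Q (Ioi a)) (hQ0 : ∀ x, a < x → 0 ≤ Q x)
    (hu : ∀ x, a < x → HasDerivAt u (deriv u x) x)
    (hdu : ∀ x, a < x → HasDerivAt (deriv u) (Q x * u x) x) (hupos : ∀ x, a < x → 0 < u x)
    (hdule : ∀ x, xf < x → |deriv u x| ≤ u xf / (x - xf))
    (huI1 : IntegrableOn (fun x => deriv u x ^ 2) (Ioi xf))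
    (huI2 : IntegrableOn (fun x => Q x * u x ^ 2) (Ioi xf))
    (hf : ∀ x, a < x → HasDerivAt f (df x) x) (hdfc : ContinuousOn df (Ioi a)) (hf0 : f xf = 0)
    (hfI1 : IntegrableOn (fun x => df x ^ 2) (Ioi xf))
    (hfI2 : IntegrableOn (fun x => Q x * f x ^ 2) (Ioi xf))
    (hA : IntegrableOn (fun x => A x ^ 2) (Ioi xf)) (d : ℝ) :
    IntegrableOn (fun x => A x ^ 2 + (df x - d * deriv u x) ^ 2 + Q x * (f x - d * u x) ^ 2) (Ioi xf) ∧
      ∫ x in Ioi xf, (A x ^ 2 + df x ^ 2 + Q x * f x ^ 2)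
        ≤ ∫ x in Ioi xf, (A x ^ 2 + (df x - d * deriv u x) ^ 2 + Q x * (f x - d * u x) ^ 2) := by
  obtain ⟨hP, hP0⟩ := static_orthogonal haxf hQc hQ0 hu hdu hupos hdule huI1 huI2 hf hdfc hf0 hfI1 hfI2
  have hbase : IntegrableOn (fun x => A x ^ 2 + df x ^ 2 + Q x * f x ^ 2) (Ioi xf) := (hA.add hfI1).add hfI2
  have hE : IntegrableOn (fun x => deriv u x ^ 2 + Q x * u x ^ 2) (Ioi xf) := huI1.add huI2
  have heq : (fun x => A x ^ 2 + (df x - d * deriv u x) ^ 2 + Q x * (f x - d * u x) ^ 2)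
      = fun x => (A x ^ 2 + df x ^ 2 + Q x * f x ^ 2) - (2 * d) * (df x * deriv u x + Q x * f x * u x)
        + d ^ 2 * (deriv u x ^ 2 + Q x * u x ^ 2) := by
    funext x; ring
  have hint : IntegrableOn (fun x => A x ^ 2 + (df x - d * deriv u x) ^ 2 + Q x * (f x - d * u x) ^ 2)
      (Ioi xf) := by
    rw [heq]
    exact (hbase.sub (hP.const_mul _)).add (hE.const_mul _)
  refine ⟨hint, ?_⟩
  have hF1 : IntegrableOn (fun x => (A x ^ 2 + df x ^ 2 + Q x * f x ^ 2)
      - (2 * d) * (df x * deriv u x + Q x * f x * u x)) (Ioi xf) := hbase.sub (hP.const_mul _)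
  have hsplit : ∫ x in Ioi xf, ((A x ^ 2 + df x ^ 2 + Q x * f x ^ 2)
      - (2 * d) * (df x * deriv u x + Q x * f x * u x) + d ^ 2 * (deriv u x ^ 2 + Q x * u x ^ 2))
      = (∫ x in Ioi xf, (A x ^ 2 + df x ^ 2 + Q x * f x ^ 2))
        - (2 * d) * (∫ x in Ioi xf, (df x * deriv u x + Q x * f x * u x))
        + d ^ 2 * ∫ x in Ioi xf, (deriv u x ^ 2 + Q x * u x ^ 2) := by
    rw [integral_add hF1 (hE.const_mul _), integral_sub hbase (hP.const_mul _),
      MeasureTheory.integral_const_mul, MeasureTheory.integral_const_mul]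
  rw [heq, hsplit, hP0]
  have hE0 : 0 ≤ ∫ x in Ioi xf, (deriv u x ^ 2 + Q x * u x ^ 2) :=
    setIntegral_nonneg measurableSet_Ioi fun x hx => by
      have := hQ0 x (haxf.trans hx); positivity
  nlinarith [sq_nonneg d]

/-- Registered sub-goal `peel_hardyAtInfinity` of `stub_peel` (verbatim signature): the qualitative Hardy inequality at infinity `h' ∈ L² ⇒ h/x ∈ L²`. -/
theorem peel_hardyAtInfinity : ∀ (h h' : ℝ → ℝ) (X : ℝ), 0 < X → (∀ x, X ≤ x → HasDerivAt h (h' x) x) → ContinuousOn h' (Set.Ici X) → MeasureTheory.IntegrableOn (fun x => h' x ^ 2) (Set.Ioi X) → MeasureTheory.IntegrableOn (fun x => (h x / x) ^ 2) (Set.Ioi X) :=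
  fun _ _ _ hX hh hh'c hh'2 => sq_div_integrableOn_of_deriv hX hh hh'c hh'2

end Summit.FinalStateConjecture.FinalStateConjecture.Theorems.CrumPeelingRecessiveTower
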